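import Summits.AtomisticToContinuum.Crystallization.Theorems.HullExactificationCascadeHullGoodEverywhereDefs
import HarnessLib

/-!
# Scaling glue for the birth line of `ZeroDefectDensity`
# (route `HullExactificationCascade`, crux `ZeroDefectDensity`, stmt-AtomisticToContinuum-12086; line `birth`)

The birth line proves the pointwise implication "`1/4000`-softly twelve-kissed two shells deep ⇒
`SiteGood`" at scale `1` and transports it to a local scale `a > 0` by the dilation
`p ↦ a⁻¹ • p`.  This file is that transport (registered stub `stub_scaling`):

* `siteGood_of_dilate` — `SiteGood` of the dilated pair `((a⁻¹ • ·) '' S, a⁻¹ • u)` gives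
  `SiteGood S u`: the local scale dilates (`sInf_dists_dilate`), the strict `13/10 · d` shell
  dilates (`image_shell_dilate`), the rescaled recentred shell points are unchanged
  (`rescale_dilate`), and the matching is transported along the bijection induced by the
  (injective) dilation (`shellMatch_transport`), with the same linear isometry.
* `softKissing_dilate` — soft twelve-kissing at scale `a` about `v` in `S` becomes soft
  twelve-kissing at scale `1` about `a⁻¹ • v` in the dilated set (distances scale by `a⁻¹`
  (`dist_smul₀`), the count is preserved by injectivity).
* `stub_scaling` — the registered conjunction of the two.
-/

noncomputable section

namespace Summit.AtomisticToContinuum.Crystallization.Theorems.ZeroDefectDensityBirth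

open Literature.Geometry.DiscreteGeometry
open scoped Pointwise

/-! ## The dilation `p ↦ a⁻¹ • p` -/

/-- The dilation `p ↦ a⁻¹ • p` (`a > 0`) is injective. [folklore] -/
theorem dilate_injective {a : ℝ} (ha : 0 < a) :
    Function.Injective (fun p : EuclideanSpace ℝ (Fin 3) => a⁻¹ • p) :=
  MulAction.injective₀ (inv_ne_zero ha.ne')

/-- The set of distances from the dilated centre to the other points of the dilated set is the
dilated set of distances. [folklore] -/
theorem dists_dilate (S : Set (EuclideanSpace ℝ (Fin 3))) (u : EuclideanSpace ℝ (Fin 3)) {a : ℝ}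
    (ha : 0 < a) :
    (fun z => dist z (a⁻¹ • u)) ''
        ((fun p : EuclideanSpace ℝ (Fin 3) => a⁻¹ • p) '' S \ {a⁻¹ • u}) =
      a⁻¹ • ((fun z => dist z u) '' (S \ {u})) := by
  ext r
  simp only [Set.mem_image, Set.mem_sdiff, Set.mem_singleton_iff, Set.mem_smul_set, smul_eq_mul]
  constructor
  · rintro ⟨_, ⟨⟨z, hz, rfl⟩, hne⟩, rfl⟩
    refine ⟨dist z u, ⟨z, ⟨hz, fun h => hne (by rw [h])⟩, rfl⟩, ?_⟩
    rw [dist_smul₀, norm_inv, Real.norm_of_nonneg ha.le]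
  · rintro ⟨_, ⟨z, ⟨hz, hne⟩, rfl⟩, rfl⟩
    refine ⟨a⁻¹ • z, ⟨⟨z, hz, rfl⟩, fun h => hne (dilate_injective ha h)⟩, ?_⟩
    rw [dist_smul₀, norm_inv, Real.norm_of_nonneg ha.le]

/-- **The local scale dilates.** `dist(a⁻¹ • u, (a⁻¹ • S) ∖ {a⁻¹ • u}) = a⁻¹ · dist(u, S ∖ {u})`
(as `sInf`s; also in the degenerate case `S ∖ {u} = ∅`, where both sides vanish). [folklore] -/
theorem sInf_dists_dilate (S : Set (EuclideanSpace ℝ (Fin 3))) (u : EuclideanSpace ℝ (Fin 3))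
    {a : ℝ} (ha : 0 < a) :
    sInf ((fun z => dist z (a⁻¹ • u)) ''
        ((fun p : EuclideanSpace ℝ (Fin 3) => a⁻¹ • p) '' S \ {a⁻¹ • u})) =
      a⁻¹ * sInf ((fun z => dist z u) '' (S \ {u})) := by
  rw [dists_dilate S u ha, Real.sInf_smul_of_nonneg (inv_nonneg.2 ha.le), smul_eq_mul]

/-- **The shell dilates.** The strict `13/10 · d`-shell of the dilated pair is the image of the
strict `13/10 · d`-shell of `(S, u)` under the dilation. [folklore] -/
theorem image_shell_dilate (S : Set (EuclideanSpace ℝ (Fin 3))) (u : EuclideanSpace ℝ (Fin 3))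
    {a : ℝ} (ha : 0 < a) :
    (fun p : EuclideanSpace ℝ (Fin 3) => a⁻¹ • p) ''
        {z : EuclideanSpace ℝ (Fin 3) | z ∈ S ∧ z ≠ u ∧
          dist z u < 13 / 10 * sInf ((fun z => dist z u) '' (S \ {u}))} =
      {z : EuclideanSpace ℝ (Fin 3) | z ∈ (fun p : EuclideanSpace ℝ (Fin 3) => a⁻¹ • p) '' S ∧
        z ≠ a⁻¹ • u ∧ dist z (a⁻¹ • u) < 13 / 10 * sInf ((fun z => dist z (a⁻¹ • u)) ''
          ((fun p : EuclideanSpace ℝ (Fin 3) => a⁻¹ • p) '' S \ {a⁻¹ • u}))} := by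
  rw [sInf_dists_dilate S u ha]
  ext z'
  simp only [Set.mem_image, Set.mem_setOf_eq]
  constructor
  · rintro ⟨z, ⟨hz, hne, hlt⟩, rfl⟩
    refine ⟨⟨z, hz, rfl⟩, fun h => hne (dilate_injective ha h), ?_⟩
    rw [dist_smul₀, norm_inv, Real.norm_of_nonneg ha.le, mul_left_comm, mul_lt_mul_iff_right₀ (inv_pos.2 ha)]
    exact hlt
  · rintro ⟨⟨z, hz, rfl⟩, hne, hlt⟩
    refine ⟨z, ⟨hz, fun h => hne (by rw [h]), ?_⟩, rfl⟩
    rw [dist_smul₀, norm_inv, Real.norm_of_nonneg ha.le, mul_left_comm, mul_lt_mul_iff_right₀ (inv_pos.2 ha)] at hlt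
    exact hlt

/-- **Rescaled, recentred shell points are dilation invariant.**
`d'⁻¹ • (a⁻¹ • t - a⁻¹ • u) = d⁻¹ • (t - u)` with `d' = a⁻¹ · d` the dilated scale. [folklore] -/
theorem rescale_dilate (S : Set (EuclideanSpace ℝ (Fin 3))) (u : EuclideanSpace ℝ (Fin 3))
    {a : ℝ} (ha : 0 < a) (t : EuclideanSpace ℝ (Fin 3)) :
    (sInf ((fun z => dist z (a⁻¹ • u)) ''
        ((fun p : EuclideanSpace ℝ (Fin 3) => a⁻¹ • p) '' S \ {a⁻¹ • u})))⁻¹ • (a⁻¹ • t - a⁻¹ • u) =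
      (sInf ((fun z => dist z u) '' (S \ {u})))⁻¹ • (t - u) := by
  rw [sInf_dists_dilate S u ha, ← smul_sub, smul_smul, mul_inv_rev, inv_inv,
    mul_inv_cancel_right₀ ha.ne']

/-- **Transport of a shell matching along an injection.** If `f` maps the shell `T` injectively
onto `T'` and preserves the rescaled recentred points, a `1/20`-matching of `T'` with a pattern
`P` through `A` pulls back to a `1/20`-matching of `T` with `P` through the same `A`. [folklore] -/
theorem shellMatch_transport {T T' : Set (EuclideanSpace ℝ (Fin 3))}
    {f : EuclideanSpace ℝ (Fin 3) → EuclideanSpace ℝ (Fin 3)} (hf : Function.Injective f)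
    (hT : f '' T = T') {y y' : EuclideanSpace ℝ (Fin 3)} {d d' : ℝ}
    (hsc : ∀ t ∈ T, d'⁻¹ • (f t - y') = d⁻¹ • (t - y)) (P : Finset (EuclideanSpace ℝ (Fin 3)))
    (A : EuclideanSpace ℝ (Fin 3) →ₗᵢ[ℝ] EuclideanSpace ℝ (Fin 3))
    (h : ∃ e' : ↥T' ≃ ↥P, ∀ t' : ↥T',
      dist (d'⁻¹ • ((t' : EuclideanSpace ℝ (Fin 3)) - y')) (A ((e' t' : ↥P) : EuclideanSpace ℝ (Fin 3))) ≤
        1 / 20) :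
    ∃ e : ↥T ≃ ↥P, ∀ t : ↥T,
      dist (d⁻¹ • ((t : EuclideanSpace ℝ (Fin 3)) - y)) (A ((e t : ↥P) : EuclideanSpace ℝ (Fin 3))) ≤
        1 / 20 := by
  subst hT
  obtain ⟨e', he'⟩ := h
  refine ⟨(Equiv.Set.image f T hf).trans e', fun t => ?_⟩
  have hval : ((Equiv.Set.image f T hf t : ↥(f '' T)) : EuclideanSpace ℝ (Fin 3)) = f t := rfl
  have ht := he' (Equiv.Set.image f T hf t)
  rw [hval, hsc t t.2] at ht
  rw [Equiv.trans_apply]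
  exact ht

/-! ## Part (i): `SiteGood` descends along the dilation -/

/-- **`SiteGood` is dilation invariant (the direction used by the line).** For `a > 0`, if
`a⁻¹ • u` is a `1/20`-good site of `(a⁻¹ • ·) '' S`, then `u` is a `1/20`-good site of `S`:
same linear isometry, bijection composed with the dilation of the shell. [folklore] -/
theorem siteGood_of_dilate {S : Set (EuclideanSpace ℝ (Fin 3))} {u : EuclideanSpace ℝ (Fin 3)} {a : ℝ}
    (ha : 0 < a) (h : SiteGood ((fun p : EuclideanSpace ℝ (Fin 3) => a⁻¹ • p) '' S) (a⁻¹ • u)) :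
    SiteGood S u := by
  simp only [SiteGood] at h ⊢
  obtain ⟨A, hA⟩ := h
  have hT := image_shell_dilate S u ha
  have hsc : ∀ t ∈ {z : EuclideanSpace ℝ (Fin 3) | z ∈ S ∧ z ≠ u ∧
      dist z u < 13 / 10 * sInf ((fun z => dist z u) '' (S \ {u}))},
      (sInf ((fun z => dist z (a⁻¹ • u)) ''
        ((fun p : EuclideanSpace ℝ (Fin 3) => a⁻¹ • p) '' S \ {a⁻¹ • u})))⁻¹ •
          ((fun p : EuclideanSpace ℝ (Fin 3) => a⁻¹ • p) t - a⁻¹ • u) =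
        (sInf ((fun z => dist z u) '' (S \ {u})))⁻¹ • (t - u) :=
    fun t _ => rescale_dilate S u ha t
  rcases hA with h | h
  · exact ⟨A, Or.inl (shellMatch_transport (dilate_injective ha) hT hsc _ A h)⟩
  · exact ⟨A, Or.inr (shellMatch_transport (dilate_injective ha) hT hsc _ A h)⟩

/-! ## Part (ii): soft twelve-kissing dilates to scale `1` -/

/-- **Soft twelve-kissing dilates.** If every other point of `S` is at distance
`≥ (1 - 1/4000) a` from `v` and either `≤ (1 + 1/4000) a` or `≥ 131/100 · a`, with exactly twelve
in the closed `(1 + 1/4000) a`-ball, then the same holds at scale `1` about `a⁻¹ • v` in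
`(a⁻¹ • ·) '' S`. [folklore] -/
theorem softKissing_dilate {S : Set (EuclideanSpace ℝ (Fin 3))} {v : EuclideanSpace ℝ (Fin 3)} {a : ℝ}
    (ha : 0 < a)
    (h : (∀ w ∈ S, w ≠ v → (1 - 1 / 4000) * a ≤ dist v w ∧
        (dist v w ≤ (1 + 1 / 4000) * a ∨ 131 / 100 * a ≤ dist v w)) ∧
      {w ∈ S | w ≠ v ∧ dist v w ≤ (1 + 1 / 4000) * a}.ncard = 12) :
    (∀ w ∈ ((fun p : EuclideanSpace ℝ (Fin 3) => a⁻¹ • p) '' S), w ≠ (a⁻¹ • v) →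
        1 - 1 / 4000 ≤ dist (a⁻¹ • v) w ∧
          (dist (a⁻¹ • v) w ≤ 1 + 1 / 4000 ∨ 131 / 100 ≤ dist (a⁻¹ • v) w)) ∧
      {w ∈ ((fun p : EuclideanSpace ℝ (Fin 3) => a⁻¹ • p) '' S) | w ≠ (a⁻¹ • v) ∧
        dist (a⁻¹ • v) w ≤ 1 + 1 / 4000}.ncard = 12 := by
  obtain ⟨hrad, hcount⟩ := h
  constructor
  · intro w' hw' hne
    obtain ⟨w, hw, rfl⟩ := hw'
    have hwv : w ≠ v := fun h => hne (by rw [h])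
    obtain ⟨h1, h2⟩ := hrad w hw hwv
    show 1 - 1 / 4000 ≤ dist (a⁻¹ • v) (a⁻¹ • w) ∧
      (dist (a⁻¹ • v) (a⁻¹ • w) ≤ 1 + 1 / 4000 ∨ 131 / 100 ≤ dist (a⁻¹ • v) (a⁻¹ • w))
    rw [dist_smul₀, norm_inv, Real.norm_of_nonneg ha.le, inv_mul_eq_div]
    exact ⟨(le_div_iff₀ ha).2 h1,
      h2.imp (fun h => (div_le_iff₀ ha).2 h) (fun h => (le_div_iff₀ ha).2 h)⟩
  · have hset : {w ∈ ((fun p : EuclideanSpace ℝ (Fin 3) => a⁻¹ • p) '' S) | w ≠ (a⁻¹ • v) ∧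
        dist (a⁻¹ • v) w ≤ 1 + 1 / 4000} = (fun p : EuclideanSpace ℝ (Fin 3) => a⁻¹ • p) ''
          {w ∈ S | w ≠ v ∧ dist v w ≤ (1 + 1 / 4000) * a} := by
      ext w'
      simp only [Set.mem_setOf_eq, Set.mem_image]
      constructor
      · rintro ⟨⟨w, hw, rfl⟩, hne, hle⟩
        refine ⟨w, ⟨hw, fun h => hne (by rw [h]), ?_⟩, rfl⟩
        rwa [dist_smul₀, norm_inv, Real.norm_of_nonneg ha.le, inv_mul_eq_div, div_le_iff₀ ha] at hle
      · rintro ⟨w, ⟨hw, hne, hle⟩, rfl⟩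
        refine ⟨⟨w, hw, rfl⟩, fun h => hne (dilate_injective ha h), ?_⟩
        rwa [dist_smul₀, norm_inv, Real.norm_of_nonneg ha.le, inv_mul_eq_div, div_le_iff₀ ha]
    rw [hset, Set.ncard_image_of_injective _ (dilate_injective ha), hcount]

/-! ## The registered stub -/

/-- **STUB `stub_scaling` of the birth line (registered signature, verbatim).** (i) `SiteGood`
descends along the dilation `p ↦ a⁻¹ • p` (`siteGood_of_dilate`); (ii) soft twelve-kissing at
scale `a` becomes soft twelve-kissing at scale `1` after the dilation (`softKissing_dilate`).
[folklore] -/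
theorem stub_scaling : (∀ (S : Set (EuclideanSpace ℝ (Fin 3))) (u : EuclideanSpace ℝ (Fin 3)) (a : ℝ), 0 < a → Summit.AtomisticToContinuum.Crystallization.Theorems.SiteGood ((fun p : EuclideanSpace ℝ (Fin 3) => a⁻¹ • p) '' S) (a⁻¹ • u) → Summit.AtomisticToContinuum.Crystallization.Theorems.SiteGood S u) ∧ (∀ (S : Set (EuclideanSpace ℝ (Fin 3))) (v : EuclideanSpace ℝ (Fin 3)) (a : ℝ), 0 < a → ((∀ w ∈ S, w ≠ v → (1 - 1 / 4000) * a ≤ dist v w ∧ (dist v w ≤ (1 + 1 / 4000) * a ∨ 131 / 100 * a ≤ dist v w)) ∧ {w ∈ S | w ≠ v ∧ dist v w ≤ (1 + 1 / 4000) * a}.ncard = 12) → ((∀ w ∈ ((fun p : EuclideanSpace ℝ (Fin 3) => a⁻¹ • p) '' S), w ≠ (a⁻¹ • v) → 1 - 1 / 4000 ≤ dist (a⁻¹ • v) w ∧ (dist (a⁻¹ • v) w ≤ 1 + 1 / 4000 ∨ 131 / 100 ≤ dist (a⁻¹ • v) w)) ∧ {w ∈ ((fun p : EuclideanSpace ℝ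 (Fin 3) => a⁻¹ • p) '' S) | w ≠ (a⁻¹ • v) ∧ dist (a⁻¹ • v) w ≤ 1 + 1 / 4000}.ncard = 12)) := by
  exact ⟨fun S u a ha h => siteGood_of_dilate ha h, fun S v a ha h => softKissing_dilate ha h⟩

end Summit.AtomisticToContinuum.Crystallization.Theorems.ZeroDefectDensityBirth

end
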